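/-
Copyright: literature formalisation (no new mathematics).  Bałaban, *Propagators and renormalization transformations for
lattice gauge theories. II*, Commun. Math. Phys. 96 (1984) 223–250 — the cube cover 𝒟 = ⋃_j 𝒟_j of the (k+1)-level
geometry and its partition of unity (2.36), with Proposition 2.3 instantiated on it.
-/
import Mathlib
import Literature.MathematicalPhysics.QuantumFieldTheory.Balaban1983to89.B6TowerSums

/-!
# [B6] The cube cover 𝒟 = ⋃_{j=0}^{k} 𝒟_j and the partition of unity (2.36) on the (k+1)-LEVEL TOWER — every cover binder
# of Proposition 2.3 discharged on `B6LevelTower.twGeo`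

CITATION HEADER (unit b2b-balaban-b06-g22, gen 22; the imported modules are not modified).  Source: T. Bałaban,
*Propagators and renormalization transformations for lattice gauge theories. II*, Commun. Math. Phys. **96** (1984)
223–250 [Balaban1984PropagatorsII] (= [B6]); the profile h of [B5] = *… I*, Commun. Math. Phys. **95** (1984) 17–40
[Balaban1984PropagatorsI], (1.118) p. 36.  Renders read AS IMAGES this generation: p. 229 (the cover 𝒟 and (2.36)) and
p. 230 (the cubes *"connected with a L^jη-scale"*); pp. 235, 238 and [B5] p. 36 as certified in the header of
`B6CoverTwoLevel` (same lineage).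

THE PRINTED TEXT (p. 229, verbatim): *"Each set Λ_j is a sum of big blocks of the size ML^jη … We cover B^j(Λ_j) by a sum
of cubes □ of the size 2ML^jη, each cube being a sum of 2^d big blocks with a center y ∈ Λ_j (more exactly it belongs to
the boundary of this set also). Taking these covers for all j from 0 to k we get a family 𝒟 of cubes □ of different sizes
and such that T_η = ⋃_{□∈𝒟} □. We will identify this family of cubes with the set of centers of these cubes. We construct
also the corresponding family of functions h described in (1.118), and rescale them to proper scales. They satisfy
Σ_{□∈𝒟} h_□² = 1. (2.36)"*; (p. 230) *"Let us assume that □ is a cube connected with a L^jη-scale (i.e. a cube of the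
size 2ML^jη) and intersecting maybe the domain B^{j+1}(Λ_{j+1}). … If □ ⊂ B^j(Λ_j), then … If □ intersects both domains
B^j(Λ_j) and B^{j+1}(Λ_{j+1}), then …"*; (p. 235) *"let us take a second cube □̃ containing □ in the middle and of the
size 4M … We assume that either □̃ ⊂ B^j(Λ_j), or it intersects B^{j+1}(Λ_{j+1}) also"*; (p. 238) *"gives a factor
O(M^{−1})"*, Proposition 2.3 (2.85)–(2.87).

THE POINT.  `B6CoverTwoLevel` built the cover and the partition of unity on a TWO-level carrier (one interface) and
`B6TowerSums` discharged every GEOMETRY-side binder of the Proposition 2.3 engine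
`B6Prop23CubeDepth.prop23_assembled_fine_twoLevel_cubes` on the full (k+1)-level tower `B6LevelTower.twGeo` (k + 1
levels, k interfaces, the level separation (2.2) with content).  This module closes the remaining MODELLING half: the
cover 𝒟 = ⋃_{l=0}^{k} 𝒟_l of the whole tower — for every level l the complete (1.118)-family of 2M-cubes of 𝒟_l with
centres on the M-lattice {0, M, …, nM}^d of the level-l box (side a = nM), each read at EVERY site of the tower through
the level-l frame `B6TowerSums.frame` (*"rescale them to proper scales"*) — and its partition of unity h_□ = h̃_□·S^{−1∕2}
((2.36) on the whole tower), and discharges EVERY cover-side binder of the engine on `twGeo d k (nM) M L η R`: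
finite overlap `hover` (n₀ = 3·2^d: a site meets cubes of its own level and of the two adjacent ones), `hpf01`, `hph`,
`h236`, the Lipschitz bound `hLip` (s = (1 + 3·2^{d+1})·(3π∕2)·L), the two-scale structure `hcube` (j_□ := the finest
level □ meets), the support gap `hgap` (m_g = 1∕(3L)), the zones `hN`, `hκ` (κ = 1∕(2L)), `hpfsq`, `hhsq`, the collar
`hcollar` (M_c = M∕L), `hzone`, `hdepth`.  With the geometry side taken BY NAME from `B6TowerSums.twGeo_prop23_geometry`
the edge theorem `prop23_assembled_towerBox` is Proposition 2.3 on the (k+1)-level tower with its cube cover, every k,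
keeping verbatim only the analytic data (kernels X, X̃_□, C_□, the fine-lattice operators G′, G′(□̃), D, χ, Q′, the sizes
of η, R, M and the rates).

WHAT THIS MODULE PROVES.  §1 frames along bonds: one admissible bond moves the level-l frame by exactly L^{min(j,j′)−l}
in ℓ¹ (`sum_abs_frame_sub_eq_of_adj`), hence by ≤ L as long as one end has level ≤ l + 1; the FIRST-EXIT lemma
`exists_exit` (a contour leaving a set of sites of levels ≤ l + 1 has moved the level-l frame by ≤ L per bond up to its
first site outside); the explicit frames of the adjacent levels (`frame_of_above`, `frame_of_below`).  §2 the cover: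
`pre` (h̃_□), `InCube` (□), `InBig` (□̃), `cubeInd`, `sqS` (S = Σ h̃²), `hfun` (h_□), `zone` (N_□), `js` (j_□); upward
blindness of □ and □̃ (`lvl_le_of_inCube`, `lvl_le_of_inBig`, from `B6TowerSums.lvl_le_of_inReach`) and the downward
threshold L ≤ n of □ (`le_lvl_of_inCube`, the presupposition R ≥ L of `B6TowerSums.le_lvl_of_inReach`); 1 ≤ S
(`one_le_sqS`: the own-level family is complete), (2.36) (`sum_hfun_sq`), the overlap count (`card_filter_hfun_ne_zero_le`),
the Lipschitz bounds (`abs_hfun_sub_le_of_adj`, `abs_hfun_sub_le`), the two-scale structure of every cube with the right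
scale index (`js_spec`), the support gap (`gap_of_cubeInd_eq_zero`) and the collar (`collar`) by the first-exit lemma,
non-empty zones (`zone_nonempty`), and the interface witnesses `inCube_above` ∕ `inCube_below` (the cover DOES straddle
every interface: the far-face cubes of 𝒟_l contain the near face of level l + 1, the near-face cubes of 𝒟_{l+1} contain
the far corner of level l).  §3 the edge theorem `prop23_assembled_towerBox`.  §4 `towerCover_nonvacuous`: the side
conditions (M ≥ 1, n ≥ 5, 1 ≤ L ≤ n, 0 ≤ w, 2wL ≤ M, 0 ≤ RM ≤ nM + 1) hold together on a tower with k = 2 (three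
levels, two interfaces), where every zone is non-empty, (2.36) holds at every site, at most 3·2^d cubes meet a site,
every cube is two-scale, and cubes of the cover straddle both interfaces.

TYPING ∕ DIVERGENCE (D-b06.42).  (i) As in `B6CoverTwoLevel` (D-b06.38) the matching of the families 𝒟_l across the
interfaces, which the text leaves implicit in *"rescale them to proper scales. They satisfy (2.36)"*, is the explicit
convention h_□ := h̃_□·S^{−1∕2}, S := Σ_{□∈𝒟} h̃_□² (1 ≤ S ≤ 3 on the tower); (2.36) then holds exactly.  (ii) j_□ :=
the finest level □ meets: a cube of 𝒟_l centred on the far part of its box meets levels l, l + 1 (j_□ = l, the printed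
*"cube connected with a L^jη-scale … intersecting maybe B^{j+1}(Λ_{j+1})"*), a cube of 𝒟_l centred ON the near face
x₀ = off_l reaches one big block ML^l = (ML)·L^{l−1} into level l − 1 (j_□ = l − 1) — the print describes only the former
kind; the engine treats both uniformly through `hcube` and (2.81) at the scale L^{j_□}η.  (iii) The two-scale structure of
□ needs the thickness presupposition L ≤ n, i.e. R ≥ L for a + 1 = RM (`B6TowerSums` G-B6-13: the print never states it;
for □̃, □̃², T_□ it would be R ≥ 2L, 3L, 4L — NOT needed here: collar and gap use only upward blindness).  (iv) The model's
constants carry L (s ∝ L, m_g = 1∕(3L), M_c = M∕L, κ = 1∕(2L)): d of (2.46) measures a level-(l+1) bond inside a level-l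
cube as ONE unit although it is L level-l spacings long; the printed O(1) of (2.85) is uniform in L only after the
print's rescaling argument, which is not modelled.  (v) h ∈ C₀^∞ is used only through the Lipschitz bound; the tower is
the coordinatised box tower of `B6LevelTower` (one box of (nM + 1)^d sites per level), not a general sequence Ω_j.

HONEST SCOPE.  A modelling leaf: the cube cover of the multi-level geometry and Proposition 2.3 on it, kernel-checked,
every cover and geometry binder discharged, the analytic binders kept verbatim.  NOT summit progress (no statement about
continuum Yang–Mills or a mass gap is touched), NOT the printed L-free O(1), NOT the continuum or infinite-volume limit,
NOT a Clay-level claim.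
-/

namespace Literature.MathematicalPhysics.QuantumFieldTheory.Balaban1983to89.B6TowerCover

open Finset Real
open B4Sect5Torus (IsPseudoDist)
open B6DomainChange (Profile)
open B6RandomWalk (HasMajorant Ineq260 Triangle254)
open B6RandomWalkHom (HasMajorantHom)
open B6DomainMajorant (Ctot)
open B6Expansion282 (kerOp locOp Cglued R282)
open B6Prop23Chain (mat)
open B6Lemma21Repaired (Ineq261With Ineq263With)
open B6Ineq268 (LevelSep)
open B6Prop23TwoLevel (K285TL)
open B6Prop23CubeDepth (prop23_assembled_fine_twoLevel_cubes depth_interface)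
open B6CoverBox (ctr)
open B6CoverTwoLevel (bump InCubeR InBigR bump_nonneg bump_le_one inCubeR_of_bump_ne_zero sum_bump_sq_eq_one
  sum_bump_sq_le_one card_filter_bump_ne_zero_le abs_bump_sub_le exists_gt_of_not_inCubeR exists_gt_of_not_inBigR
  abs_inv_sqrt_sub_le not_inBigR_of_far zv)
open B6LevelTower (TW lvl lvl_le off off_zero off_succ pos graph pos_step graph_connected tdist tdist_self tdist_comm
  tdist_nonneg cornerA adj_wall twGeo)
open B6TowerSums (frame frame_self InReach lvl_le_of_inReach le_lvl_of_inReach frame_zero_ge_of_above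
  frame_zero_le_of_below twGeo_prop23_geometry Ktw Ktw_nonneg pos_mk)

/-! ## §1  Level frames along admissible bonds; the first-exit lemma; the frames of the adjacent levels -/

section Frames

variable {d k a : ℕ} [NeZero d]

/-- The difference of level-l frames is the difference of positions over L^l. [cite: Balaban1984PropagatorsII, (2.1)–(2.3) p.224] -/
theorem frame_sub (L l : ℕ) (y y' : TW d k a) (μ : Fin d) :
    frame L l y μ - frame L l y' μ = (((pos L y μ - pos L y' μ : ℤ)) : ℝ) / (L : ℝ) ^ l := by
  unfold frame
  push_cast
  ring

/-- **One admissible bond moves the level-l frame by exactly L^{min(j, j′)} ∕ L^l in ℓ¹** (one coordinate of the position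
moves by L^{min(j, j′)}, `B6LevelTower.pos_step`). [cite: Balaban1984PropagatorsII, (2.46) p.231 + (2.1)–(2.3) p.224] -/
theorem sum_abs_frame_sub_eq_of_adj (L l : ℕ) {y y' : TW d k a} (h : (graph L).Adj y y') :
    ∑ μ, |frame L l y μ - frame L l y' μ| = (L : ℝ) ^ min (lvl y) (lvl y') / (L : ℝ) ^ l := by
  obtain ⟨μ, hν, hμ⟩ := pos_step h
  rw [Finset.sum_eq_single μ (fun ν _ hne => by
      rw [frame_sub, hν ν hne, sub_self, Int.cast_zero, zero_div, abs_zero])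
    (fun hμ' => absurd (Finset.mem_univ μ) hμ')]
  rw [frame_sub, abs_div, abs_of_nonneg (by positivity : (0 : ℝ) ≤ (L : ℝ) ^ l), ← Int.cast_abs, hμ, Int.cast_pow,
    Int.cast_natCast]

/-- … hence by at most L whenever one end of the bond has level ≤ l + 1 (L ≥ 1). [cite: Balaban1984PropagatorsII, (2.46) p.231] -/
theorem sum_abs_frame_sub_le_of_adj {L : ℕ} (hL : 1 ≤ L) {l : ℕ} {y y' : TW d k a} (h : (graph L).Adj y y')
    (hmin : min (lvl y) (lvl y') ≤ l + 1) : ∑ μ, |frame L l y μ - frame L l y' μ| ≤ L := by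
  have hL' : (1 : ℝ) ≤ L := by exact_mod_cast hL
  rw [sum_abs_frame_sub_eq_of_adj L l h, div_le_iff₀ (by positivity)]
  calc (L : ℝ) ^ min (lvl y) (lvl y') ≤ (L : ℝ) ^ (l + 1) := pow_le_pow_right₀ hL' hmin
    _ = L * (L : ℝ) ^ l := by ring

/-- **Potentials on the tower**: a function changing by at most c along every admissible bond changes by at most c·d(y, y′)
between any two sites (sum along a shortest contour). [folklore] -/
theorem abs_sub_le_mul_tdist (L : ℕ) {Φ : TW d k a → ℝ} {c : ℝ}
    (hΦ : ∀ y y', (graph L).Adj y y' → |Φ y - Φ y'| ≤ c) (y y' : TW d k a) : |Φ y - Φ y'| ≤ c * tdist L y y' := by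
  obtain ⟨p, hp⟩ := ((graph_connected (d := d) (k := k) (a := a) L).preconnected y y').exists_walk_length_eq_dist
  unfold tdist
  rw [← hp]
  clear hp
  induction p with
  | nil => simp
  | @cons u v w h p ih =>
    rw [SimpleGraph.Walk.length_cons]
    push_cast
    calc |Φ u - Φ w| ≤ |Φ u - Φ v| + |Φ v - Φ w| := abs_sub_le _ _ _
      _ ≤ c + c * (p.length : ℝ) := add_le_add (hΦ u v h) ih
      _ = c * ((p.length : ℝ) + 1) := by ring

/-- **THE FIRST-EXIT LEMMA.**  Let P be a set of sites all of level ≤ l + 1 (a printed cube object of level l: □, □̃ —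
upward blind).  An admissible contour from a site of P to a site outside P contains a site x ∉ P such that the level-l
frame has moved by at most L·(number of bonds) in ℓ¹ between the start and x: up to the first exit every bond starts in
P, hence at level ≤ l + 1, and moves the frame by ≤ L. [cite: Balaban1984PropagatorsII, (2.46) p.231 + p.235 before (2.70)] -/
theorem exists_exit {L : ℕ} (hL : 1 ≤ L) (l : ℕ) {P : TW d k a → Prop} (hP : ∀ x, P x → lvl x ≤ l + 1)
    {u v : TW d k a} (W : (graph L).Walk u v) (hu : P u) (hv : ¬ P v) :
    ∃ x, ¬ P x ∧ ∑ μ, |frame L l u μ - frame L l x μ| ≤ L * W.length := by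
  induction W with
  | nil => exact absurd hu hv
  | @cons u' v' w' h p ih =>
    have hstep : ∑ μ, |frame L l u' μ - frame L l v' μ| ≤ L :=
      sum_abs_frame_sub_le_of_adj hL h ((min_le_left _ _).trans (hP u' hu))
    rw [SimpleGraph.Walk.length_cons]
    push_cast
    by_cases hv' : P v'
    · obtain ⟨x, hx, hb⟩ := ih hv' hv
      refine ⟨x, hx, ?_⟩
      calc ∑ μ, |frame L l u' μ - frame L l x μ|
          ≤ ∑ μ, (|frame L l u' μ - frame L l v' μ| + |frame L l v' μ - frame L l x μ|) :=
            Finset.sum_le_sum fun μ _ => abs_sub_le _ _ _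
        _ = ∑ μ, |frame L l u' μ - frame L l v' μ| + ∑ μ, |frame L l v' μ - frame L l x μ| := Finset.sum_add_distrib
        _ ≤ L + L * (p.length : ℝ) := add_le_add hstep hb
        _ = L * ((p.length : ℝ) + 1) := by ring
    · refine ⟨v', hv', ?_⟩
      have : (0 : ℝ) ≤ L * (p.length : ℝ) := by positivity
      linarith

/-- **The frame of the level ABOVE**: a site of level l + 1 with index x has level-l frame ((a + 1)·[μ = 0] + L x_μ)_μ —
the level-(l+1) box starts one wall bond beyond the far face of the level-l box and has spacing L in level-l units.
[cite: Balaban1984PropagatorsII, (2.1)–(2.3) p.224] -/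
theorem frame_of_above {L : ℕ} (hL : 1 ≤ L) {y : TW d k a} {l : ℕ} (h : lvl y = l + 1) (μ : Fin d) :
    frame L l y μ = (if μ = 0 then (a : ℝ) + 1 else 0) + L * ((y.2 μ : ℕ) : ℝ) := by
  have hLpos : (0 : ℝ) < L := by exact_mod_cast hL
  unfold frame
  rw [div_eq_iff (by positivity)]
  simp only [pos, h, zv]
  by_cases hμ : μ = 0
  · simp only [hμ, if_true, off_succ]
    push_cast
    ring
  · simp only [hμ, if_false]
    push_cast
    ring

/-- **The frame of the level BELOW**: a site of level l − 1 with index x has level-l frame ((x₀ − a − 1)∕L, x₁∕L, …) — it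
lies within [−(a + 1)∕L, −1∕L] × [0, a∕L]^{d−1}. [cite: Balaban1984PropagatorsII, (2.1)–(2.3) p.224] -/
theorem frame_of_below {L : ℕ} (hL : 1 ≤ L) {y : TW d k a} {l : ℕ} (h : lvl y + 1 = l) (μ : Fin d) :
    frame L l y μ = (if μ = 0 then ((y.2 0 : ℕ) : ℝ) - ((a : ℝ) + 1) else ((y.2 μ : ℕ) : ℝ)) / L := by
  subst h
  have hLpos : (0 : ℝ) < L := by exact_mod_cast hL
  unfold frame
  rw [div_eq_div_iff (by positivity) hLpos.ne']
  simp only [pos, zv]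
  by_cases hμ : μ = 0
  · subst hμ
    simp only [if_true, off_succ]
    push_cast
    ring
  · simp only [hμ, if_false]
    push_cast
    ring

end Frames

/-! ## §2  The cover 𝒟 = ⋃_l 𝒟_l of the tower and its partition of unity -/

section Cover

variable {d k n a : ℕ} [NeZero d]

/-- The index set of the cover 𝒟 = ⋃_{l=0}^{k} 𝒟_l: a cube is (its level l, its centre index c ∈ {0, …, n}^d) — *"We will
identify this family of cubes with the set of centers of these cubes"*, centres on the M-lattice of the level-l box incl.
its boundary. [cite: Balaban1984PropagatorsII, p.229 before (2.36)] -/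
abbrev Idx (d k n : ℕ) : Type := Fin (k + 1) × (Fin d → Fin (n + 1))

/-- The RESCALED profile h̃_□ of the cube □ = (l, c) (*"rescale them to proper scales"*): the product profile of [B5]
(1.118) centred at cM, read in the level-l frame of an arbitrary site of the tower. [cite: Balaban1984PropagatorsII, p.229 before (2.36)] -/
noncomputable def pre (m L : ℕ) (i : Idx d k n) (y : TW d k a) : ℝ := bump m i.2 (frame L (i.1 : ℕ) y)

/-- y ∈ □ for □ = (l, c): the 2M-cube |frame_l(y)_μ − c_μM| ≤ M (*"cubes □ of the size 2ML^jη"*). [cite: Balaban1984PropagatorsII, p.229 before (2.36)] -/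
def InCube (m L : ℕ) (i : Idx d k n) (y : TW d k a) : Prop := InCubeR m i.2 (frame L (i.1 : ℕ) y)

/-- y ∈ □̃, the *"second cube □̃ containing □ in the middle and of the size 4M"*. [cite: Balaban1984PropagatorsII, p.235 before (2.70)] -/
def InBig (m L : ℕ) (i : Idx d k n) (y : TW d k a) : Prop := InBigR m i.2 (frame L (i.1 : ℕ) y)

/-- The multiplication operator □ of (2.70) ∕ (2.82): the indicator of □. [cite: Balaban1984PropagatorsII, (2.70) p.235] -/
noncomputable def cubeInd (m L : ℕ) (i : Idx d k n) (y : TW d k a) : ℝ := by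
  classical exact if InCube m L i y then 1 else 0

/-- S(y) := Σ_{□∈𝒟} h̃_□(y)², the plain square sum of all the rescaled families. [cite: Balaban1984PropagatorsII, (2.36) p.229] -/
noncomputable def sqS (n m L : ℕ) (y : TW d k a) : ℝ := ∑ i : Idx d k n, pre m L i y ^ 2

/-- **THE PARTITION OF UNITY OF THE MODEL**: h_□ := h̃_□·S^{−1∕2}, the explicit matching convention under which the
rescaled families *"satisfy Σ_{□∈𝒟} h_□² = 1. (2.36)"* on the whole tower (DIVERGENCE D-b06.42 (i)). [cite: Balaban1984PropagatorsII, (2.36) p.229] -/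
noncomputable def hfun (m L : ℕ) (i : Idx d k n) (y : TW d k a) : ℝ := pre m L i y / Real.sqrt (sqS n m L y)

/-- The zone N_□ := {y : d(y, □̃ᶜ) ≤ w}. [cite: Balaban1984PropagatorsII, p.235 before (2.70); (2.83) p.237] -/
noncomputable def zone (m L : ℕ) (w : ℝ) (i : Idx d k n) : Finset (TW d k a) := by
  classical exact Finset.univ.filter fun y => ∃ z, ¬ InBig m L i z ∧ tdist L y z ≤ w

/-- The SCALE INDEX j_□ of a cube (*"a cube connected with a L^jη-scale"*): the finest level the cube meets — its own level
l, except for the cubes centred on the near face x₀ = off_l of their box, which reach into level l − 1 (D-b06.42 (ii)).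
[cite: Balaban1984PropagatorsII, p.230 + (2.81) p.237] -/
def js (i : Idx d k n) : ℕ := if (i.2 0 : ℕ) = 0 then (i.1 : ℕ) - 1 else (i.1 : ℕ)

/-- □ is the printed cube object of half-width M centred at cM (`B6TowerSums.InReach`). [cite: Balaban1984PropagatorsII, p.229 before (2.36)] -/
theorem inCube_iff (m L : ℕ) (i : Idx d k n) (y : TW d k a) :
    InCube m L i y ↔ InReach L (m : ℝ) (i.1 : ℕ) (ctr m i.2) y := Iff.rfl

/-- □̃ is the printed cube object of half-width 2M centred at cM. [cite: Balaban1984PropagatorsII, p.235 before (2.70)] -/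
theorem inBig_iff (m L : ℕ) (i : Idx d k n) (y : TW d k a) :
    InBig m L i y ↔ InReach L (2 * (m : ℝ)) (i.1 : ℕ) (ctr m i.2) y := Iff.rfl

/-- □ ⊂ □̃. [cite: Balaban1984PropagatorsII, p.235 before (2.70)] -/
theorem inBig_of_inCube {m L : ℕ} {i : Idx d k n} {y : TW d k a} (h : InCube m L i y) : InBig m L i y := by
  intro μ
  have h1 : |frame L (i.1 : ℕ) y μ - ctr m i.2 μ| ≤ m := h μ
  have h2 : (0 : ℝ) ≤ m := Nat.cast_nonneg m
  show |frame L (i.1 : ℕ) y μ - ctr m i.2 μ| ≤ 2 * m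
  linarith

omit [NeZero d] in
/-- The centre of a cube lies in its level box: 0 ≤ c_μM. [folklore] -/
theorem ctr_nonneg (m : ℕ) (c : Fin d → Fin (n + 1)) (μ : Fin d) : 0 ≤ ctr m c μ := by
  rw [ctr]
  positivity

omit [NeZero d] in
/-- … and c_μM ≤ nM = a. [folklore] -/
theorem ctr_le (m : ℕ) (c : Fin d → Fin (n + 1)) (μ : Fin d) : ctr m c μ ≤ ((n * m : ℕ) : ℝ) := by
  rw [ctr]
  push_cast
  exact mul_le_mul_of_nonneg_right (by exact_mod_cast Nat.lt_succ_iff.mp (c μ).isLt) (Nat.cast_nonneg m)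

/-- **Upward blindness of □**: a cube of 𝒟_l contains no site of level ≥ l + 2 (n ≥ 1, L ≥ 1). [cite: Balaban1984PropagatorsII, p.230] -/
theorem lvl_le_of_inCube {m L : ℕ} (hL : 1 ≤ L) (hn : 1 ≤ n) {i : Idx d k n} {y : TW d k (n * m)}
    (h : InCube m L i y) : lvl y ≤ (i.1 : ℕ) + 1 := by
  have hL' : (1 : ℝ) ≤ L := by exact_mod_cast hL
  refine lvl_le_of_inReach hL (ctr_le m i.2 0) ?_ ((inCube_iff m L i y).mp h)
  have h1 : (m : ℝ) ≤ ((n * m : ℕ) : ℝ) := by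
    push_cast
    exact le_mul_of_one_le_left (Nat.cast_nonneg m) (by exact_mod_cast hn)
  have h2 : ((n * m : ℕ) : ℝ) + 1 ≤ (((n * m : ℕ) : ℝ) + 1) * L := le_mul_of_one_le_right (by positivity) hL'
  linarith

/-- **Upward blindness of □̃**: the 4M-cube of a cube of 𝒟_l contains no site of level ≥ l + 2 (n ≥ 2, L ≥ 1) — *"either
□̃ ⊂ B^j(Λ_j), or it intersects B^{j+1}(Λ_{j+1}) also"*. [cite: Balaban1984PropagatorsII, p.235 before (2.70)] -/
theorem lvl_le_of_inBig {m L : ℕ} (hL : 1 ≤ L) (hn : 2 ≤ n) {i : Idx d k n} {y : TW d k (n * m)}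
    (h : InBig m L i y) : lvl y ≤ (i.1 : ℕ) + 1 := by
  have hL' : (1 : ℝ) ≤ L := by exact_mod_cast hL
  refine lvl_le_of_inReach hL (ctr_le m i.2 0) ?_ ((inBig_iff m L i y).mp h)
  have h1 : 2 * (m : ℝ) ≤ ((n * m : ℕ) : ℝ) := by
    push_cast
    exact mul_le_mul_of_nonneg_right (by exact_mod_cast hn) (Nat.cast_nonneg m)
  have h2 : ((n * m : ℕ) : ℝ) + 1 ≤ (((n * m : ℕ) : ℝ) + 1) * L := le_mul_of_one_le_right (by positivity) hL'
  linarith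

/-- **The downward threshold of □**: under L ≤ n (the presupposition R ≥ L of `B6TowerSums.le_lvl_of_inReach`, with
a + 1 = nM + 1 ≥ RM) a cube of 𝒟_l contains no site of level ≤ l − 2 (D-b06.42 (iii)). [cite: Balaban1984PropagatorsII, (2.2) p.224 + p.230] -/
theorem le_lvl_of_inCube {m L : ℕ} (hL : 1 ≤ L) (hLn : L ≤ n) {i : Idx d k n} {y : TW d k (n * m)}
    (h : InCube m L i y) : (i.1 : ℕ) ≤ lvl y + 1 := by
  refine le_lvl_of_inReach hL (ctr_nonneg m i.2 0) ?_ ((inCube_iff m L i y).mp h)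
  have hLn' : (L : ℝ) ≤ n := by exact_mod_cast hLn
  calc (m : ℝ) * (L : ℝ) ^ 2 = (m * L) * L := by ring
    _ ≤ (m * L) * n := mul_le_mul_of_nonneg_left hLn' (by positivity)
    _ = ((n * m : ℕ) : ℝ) * L := by push_cast; ring
    _ ≤ (((n * m : ℕ) : ℝ) + 1) * L := mul_le_mul_of_nonneg_right (le_add_of_nonneg_right zero_le_one) (Nat.cast_nonneg L)
    _ < (((n * m : ℕ) : ℝ) + 1) * L + 1 := lt_add_one _

/-- h̃_□ ≥ 0. [cite: Balaban1984PropagatorsI, (1.118) p.36] -/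
theorem pre_nonneg (m L : ℕ) (i : Idx d k n) (y : TW d k a) : 0 ≤ pre m L i y := bump_nonneg m i.2 _

/-- h̃_□ ≤ 1. [cite: Balaban1984PropagatorsI, (1.118) p.36] -/
theorem pre_le_one (m L : ℕ) (i : Idx d k n) (y : TW d k a) : pre m L i y ≤ 1 := bump_le_one m i.2 _

/-- supp h̃_□ ⊂ □. [cite: Balaban1984PropagatorsII, p.229 (2.36)] -/
theorem inCube_of_pre_ne_zero {m : ℕ} (hm : 0 < m) {L : ℕ} {i : Idx d k n} {y : TW d k a} (h : pre m L i y ≠ 0) :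
    InCube m L i y :=
  inCubeR_of_bump_ne_zero hm h

/-- The cube indicator takes the values 0, 1 (binder `hpf01`). [folklore] -/
theorem cubeInd_zero_or_one (m L : ℕ) (i : Idx d k n) (y : TW d k a) : cubeInd m L i y = 0 ∨ cubeInd m L i y = 1 := by
  unfold cubeInd
  split_ifs
  · exact Or.inr rfl
  · exact Or.inl rfl

/-- The cube indicator is 1 on □. [folklore] -/
theorem cubeInd_eq_one {m L : ℕ} {i : Idx d k n} {y : TW d k a} (h : InCube m L i y) : cubeInd m L i y = 1 := by
  unfold cubeInd
  rw [if_pos h]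

/-- A site where the cube indicator is non-zero lies in □ (binder `hpfsq`). [folklore] -/
theorem inCube_of_cubeInd_ne_zero {m L : ℕ} {i : Idx d k n} {y : TW d k a} (h : cubeInd m L i y ≠ 0) :
    InCube m L i y := by
  by_contra h'
  apply h
  unfold cubeInd
  rw [if_neg h']

/-- **1 ≤ S on the whole tower**: at a site of level l the family 𝒟_l alone has square sum exactly 1 — (1.118) in the
level-l frame, where the site's frame is its own index x ∈ [0, nM]^d. [cite: Balaban1984PropagatorsI, (1.118) p.36] [cite: Balaban1984PropagatorsII, (2.36) p.229] -/
theorem one_le_sqS {m L : ℕ} (hm : 0 < m) (hL : 1 ≤ L) (y : TW d k (n * m)) : 1 ≤ sqS n m L y := by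
  have hown : ∑ c : Fin d → Fin (n + 1), bump m c (frame L (lvl y) y) ^ 2 = 1 := by
    refine sum_bump_sq_eq_one hm (fun μ => ?_) (fun μ => ?_)
    · rw [frame_self hL]
      exact Nat.cast_nonneg _
    · rw [frame_self hL]
      exact_mod_cast Nat.lt_succ_iff.mp (y.2 μ).isLt
  have hown' : ∑ c : Fin d → Fin (n + 1), pre m L ((y.1, c) : Idx d k n) y ^ 2 = 1 := hown
  rw [sqS, Fintype.sum_prod_type, ← hown']
  exact Finset.single_le_sum (f := fun l : Fin (k + 1) => ∑ c : Fin d → Fin (n + 1), pre m L ((l, c) : Idx d k n) y ^ 2)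
    (fun l _ => Finset.sum_nonneg fun c _ => sq_nonneg _) (Finset.mem_univ y.1)

/-- **(2.36) ON THE WHOLE TOWER**: Σ_{□∈𝒟} h_□(y)² = 1 at every site of every level (the binder `h236`).
[cite: Balaban1984PropagatorsII, (2.36) p.229] -/
theorem sum_hfun_sq {m L : ℕ} (hm : 0 < m) (hL : 1 ≤ L) (y : TW d k (n * m)) :
    ∑ i : Idx d k n, hfun m L i y ^ 2 = 1 := by
  have hS : 1 ≤ sqS n m L y := one_le_sqS hm hL y
  have hS0 : 0 < sqS n m L y := by linarith
  simp only [hfun, div_pow, Real.sq_sqrt hS0.le, ← Finset.sum_div]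
  rw [← sqS]
  exact div_self hS0.ne'

/-- h_□ ≥ 0. [cite: Balaban1984PropagatorsII, p.229 (2.36)] -/
theorem hfun_nonneg (m L : ℕ) (i : Idx d k n) (y : TW d k a) : 0 ≤ hfun m L i y :=
  div_nonneg (pre_nonneg m L i y) (Real.sqrt_nonneg _)

/-- supp h_□ = supp h̃_□ (⊂ □: binder `hhsq`). [cite: Balaban1984PropagatorsII, p.229 (2.36)] -/
theorem pre_ne_zero_of_hfun_ne_zero {m L : ℕ} {i : Idx d k n} {y : TW d k a} (h : hfun m L i y ≠ 0) :
    pre m L i y ≠ 0 := fun h0 => h (by rw [hfun, h0, zero_div])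

/-- **□·h_□ = h_□** (the binder `hph`). [cite: Balaban1984PropagatorsII, (2.70) p.235; (2.82) p.237] -/
theorem cubeInd_mul_hfun {m : ℕ} (hm : 0 < m) (L : ℕ) (i : Idx d k n) (y : TW d k a) :
    cubeInd m L i y * hfun m L i y = hfun m L i y := by
  by_cases h : pre m L i y = 0
  · rw [hfun, h, zero_div, mul_zero]
  · rw [cubeInd_eq_one (inCube_of_pre_ne_zero hm h), one_mul]

/-- **Finite overlap of the cover of the tower**: at most 3·2^d of the h̃_□ are non-zero at a site — its cubes belong to
𝒟_{j−1}, 𝒟_j, 𝒟_{j+1} for j the site's level (upward blindness and the downward threshold L ≤ n), at most 2^d per level.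
[cite: Balaban1984PropagatorsII, p.229 before (2.36) + p.230] -/
theorem card_filter_pre_ne_zero_le {m L : ℕ} (hm : 0 < m) (hL : 1 ≤ L) (hLn : L ≤ n) (y : TW d k (n * m)) :
    (Finset.univ.filter fun i : Idx d k n => pre m L i y ≠ 0).card ≤ 3 * 2 ^ d := by
  classical
  have hn : 1 ≤ n := le_trans hL hLn
  set N3 : Finset (Fin (k + 1)) := Finset.univ.filter fun l => (l : ℕ) ≤ lvl y + 1 ∧ lvl y ≤ (l : ℕ) + 1 with hN3
  have hN3card : N3.card ≤ 3 := by
    calc N3.card ≤ ({lvl y - 1, lvl y, lvl y + 1} : Finset ℕ).card := by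
          refine Finset.card_le_card_of_injOn (fun l : Fin (k + 1) => (l : ℕ)) (fun l hl => ?_)
            (Set.injOn_of_injective Fin.val_injective)
          have hl' := (Finset.mem_filter.mp (Finset.mem_coe.mp hl)).2
          have h3 : (l : ℕ) = lvl y - 1 ∨ (l : ℕ) = lvl y ∨ (l : ℕ) = lvl y + 1 := by omega
          simp only [Finset.coe_insert, Finset.coe_singleton, Set.mem_insert_iff, Set.mem_singleton_iff]
          exact h3
      _ ≤ 3 := Finset.card_le_three
  set T : Fin (k + 1) → Finset (Idx d k n) := fun l =>
    (Finset.univ.filter fun c : Fin d → Fin (n + 1) => bump m c (frame L (l : ℕ) y) ≠ 0).image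
      fun c => ((l, c) : Idx d k n) with hT
  have hsub : (Finset.univ.filter fun i : Idx d k n => pre m L i y ≠ 0) ⊆ N3.biUnion T := by
    intro i hi
    obtain ⟨l, c⟩ := i
    have hpre : pre m L ((l, c) : Idx d k n) y ≠ 0 := (Finset.mem_filter.mp hi).2
    have hcube : InCube m L ((l, c) : Idx d k n) y := inCube_of_pre_ne_zero hm hpre
    rw [Finset.mem_biUnion]
    refine ⟨l, ?_, ?_⟩
    · rw [hN3, Finset.mem_filter]
      exact ⟨Finset.mem_univ _, le_lvl_of_inCube hL hLn hcube, lvl_le_of_inCube hL hn hcube⟩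
    · rw [hT, Finset.mem_image]
      exact ⟨c, Finset.mem_filter.mpr ⟨Finset.mem_univ _, hpre⟩, rfl⟩
  calc (Finset.univ.filter fun i : Idx d k n => pre m L i y ≠ 0).card ≤ (N3.biUnion T).card := Finset.card_le_card hsub
    _ ≤ ∑ l ∈ N3, (T l).card := Finset.card_biUnion_le
    _ ≤ ∑ l ∈ N3, 2 ^ d := Finset.sum_le_sum fun l _ =>
        Finset.card_image_le.trans (card_filter_bump_ne_zero_le hm (frame L (l : ℕ) y))
    _ = N3.card * 2 ^ d := by rw [Finset.sum_const, smul_eq_mul]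
    _ ≤ 3 * 2 ^ d := Nat.mul_le_mul_right _ hN3card

/-- **The finite overlap of {h_□}** (the binder `hover`, n₀ = 3·2^d). [cite: Balaban1984PropagatorsII, p.229 before (2.36)] -/
theorem card_filter_hfun_ne_zero_le {m L : ℕ} (hm : 0 < m) (hL : 1 ≤ L) (hLn : L ≤ n) (y : TW d k (n * m)) :
    (Finset.univ.filter fun i : Idx d k n => hfun m L i y ≠ 0).card ≤ 3 * 2 ^ d := by
  classical
  refine le_trans (Finset.card_le_card ?_) (card_filter_pre_ne_zero_le hm hL hLn y)
  intro i hi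
  rw [Finset.mem_filter] at hi ⊢
  exact ⟨hi.1, pre_ne_zero_of_hfun_ne_zero hi.2⟩

/-- **Along one admissible bond every h̃_□ moves by at most (3π∕2)·L∕M**: if h̃_□ vanishes at both ends there is nothing
to prove, otherwise one end lies in □, at level ≤ l + 1, and the bond moves the level-l frame by ≤ L in ℓ¹.
[cite: Balaban1984PropagatorsII, p.238 before (2.85) «gives a factor O(M⁻¹)»] -/
theorem abs_pre_sub_le_of_adj {m L : ℕ} (hm : 0 < m) (hL : 1 ≤ L) (hn : 1 ≤ n) (i : Idx d k n) {y y' : TW d k (n * m)}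
    (h : (graph L).Adj y y') : |pre m L i y - pre m L i y'| ≤ 3 * π / 2 / m * L := by
  have hc : 0 ≤ 3 * π / 2 / (m : ℝ) := by positivity
  by_cases h0 : pre m L i y = 0 ∧ pre m L i y' = 0
  · rw [h0.1, h0.2, sub_zero, abs_zero]
    positivity
  · have hmin : min (lvl y) (lvl y') ≤ (i.1 : ℕ) + 1 := by
      rcases not_and_or.mp h0 with h1 | h1
      · exact (min_le_left _ _).trans (lvl_le_of_inCube hL hn (inCube_of_pre_ne_zero hm h1))
      · exact (min_le_right _ _).trans (lvl_le_of_inCube hL hn (inCube_of_pre_ne_zero hm h1))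
    calc |pre m L i y - pre m L i y'| ≤ 3 * π / 2 / m * ∑ μ, |frame L (i.1 : ℕ) y μ - frame L (i.1 : ℕ) y' μ| :=
          abs_bump_sub_le hm i.2 _ _
      _ ≤ 3 * π / 2 / m * L := mul_le_mul_of_nonneg_left (sum_abs_frame_sub_le_of_adj hL h hmin) hc

/-- **Along one admissible bond every h_□ moves by at most (1 + 3·2^{d+1})·(3π∕2)·L∕M** — the numerator h̃_□ by
λ = (3π∕2)L∕M, the normalisation S^{−1∕2} by ½|ΔS| ≤ ½·(2·3·2^d)·2λ (at most 3·2^d cubes are active at each end, each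
square moving by ≤ 2λ). [cite: Balaban1984PropagatorsII, p.238 before (2.85) «An estimate of the terms with the commutator is even simpler and gives a factor O(M⁻¹)»] -/
theorem abs_hfun_sub_le_of_adj {m L : ℕ} (hm : 0 < m) (hL : 1 ≤ L) (hLn : L ≤ n) (i : Idx d k n)
    {y y' : TW d k (n * m)} (h : (graph L).Adj y y') :
    |hfun m L i y - hfun m L i y'| ≤ (1 + 3 * 2 ^ (d + 1)) * (3 * π / 2) * L / m := by
  classical
  have hn : 1 ≤ n := le_trans hL hLn
  set lam : ℝ := 3 * π / 2 / m * L with hlam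
  have hlam0 : 0 ≤ lam := by positivity
  set S := sqS n m L y with hSdef
  set S' := sqS n m L y' with hS'def
  have hS : 1 ≤ S := one_le_sqS hm hL y
  have hS' : 1 ≤ S' := one_le_sqS hm hL y'
  -- |S − S′| ≤ (3·2^{d+1})·2λ
  have hSS : |S - S'| ≤ (3 * 2 ^ (d + 1) : ℝ) * (2 * lam) := by
    have e : S - S' = ∑ i : Idx d k n, (pre m L i y ^ 2 - pre m L i y' ^ 2) := by
      rw [hSdef, hS'def, sqS, sqS, ← Finset.sum_sub_distrib]
    rw [e]
    set A := Finset.univ.filter fun i : Idx d k n => pre m L i y ^ 2 - pre m L i y' ^ 2 ≠ 0 with hA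
    have hterm : ∀ i : Idx d k n, |pre m L i y ^ 2 - pre m L i y' ^ 2| ≤ 2 * lam := by
      intro i
      rw [sq_sub_sq, abs_mul]
      have h1 : |pre m L i y + pre m L i y'| ≤ 2 := by
        rw [abs_of_nonneg (add_nonneg (pre_nonneg m L i y) (pre_nonneg m L i y'))]
        linarith [pre_le_one m L i y, pre_le_one m L i y']
      have h2 : |pre m L i y - pre m L i y'| ≤ lam := abs_pre_sub_le_of_adj hm hL hn i h
      exact mul_le_mul h1 h2 (abs_nonneg _) (by norm_num)
    have hAcard : A.card ≤ 3 * 2 ^ (d + 1) := by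
      have hsub : A ⊆ (Finset.univ.filter fun i : Idx d k n => pre m L i y ≠ 0) ∪
          (Finset.univ.filter fun i : Idx d k n => pre m L i y' ≠ 0) := by
        intro i hi
        rw [hA, Finset.mem_filter] at hi
        rw [Finset.mem_union, Finset.mem_filter, Finset.mem_filter]
        by_contra hcon
        rw [not_or] at hcon
        apply hi.2
        have e1 : pre m L i y = 0 := by
          by_contra h1; exact hcon.1 ⟨Finset.mem_univ _, h1⟩
        have e2 : pre m L i y' = 0 := by
          by_contra h2; exact hcon.2 ⟨Finset.mem_univ _, h2⟩
        rw [e1, e2]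
        ring
      calc A.card ≤ _ := Finset.card_le_card hsub
        _ ≤ _ := Finset.card_union_le _ _
        _ ≤ 3 * 2 ^ d + 3 * 2 ^ d :=
            add_le_add (card_filter_pre_ne_zero_le hm hL hLn y) (card_filter_pre_ne_zero_le hm hL hLn y')
        _ = 3 * 2 ^ (d + 1) := by ring
    calc |∑ i : Idx d k n, (pre m L i y ^ 2 - pre m L i y' ^ 2)|
        ≤ ∑ i : Idx d k n, |pre m L i y ^ 2 - pre m L i y' ^ 2| := Finset.abs_sum_le_sum_abs _ _
      _ = ∑ i ∈ A, |pre m L i y ^ 2 - pre m L i y' ^ 2| := by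
          rw [hA, Finset.sum_filter]
          refine Finset.sum_congr rfl fun i _ => ?_
          by_cases h0 : pre m L i y ^ 2 - pre m L i y' ^ 2 = 0
          · simp [h0]
          · simp [h0]
      _ ≤ A.card • (2 * lam) := (Finset.sum_le_card_nsmul _ _ _ fun i _ => hterm i)
      _ ≤ (3 * 2 ^ (d + 1) : ℝ) * (2 * lam) := by
          rw [nsmul_eq_mul]
          exact mul_le_mul_of_nonneg_right (by exact_mod_cast hAcard) (by positivity)
  -- |a∕√S − a′∕√S′| ≤ |a − a′|∕√S + a′·|1∕√S − 1∕√S′| ≤ λ + ½|S − S′|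
  have hsqS : 1 ≤ Real.sqrt S := Real.one_le_sqrt.2 hS
  have ha' := pre_nonneg m L i y'
  have ha'1 := pre_le_one m L i y'
  have e : hfun m L i y - hfun m L i y' =
      (pre m L i y - pre m L i y') / Real.sqrt S + pre m L i y' * (1 / Real.sqrt S - 1 / Real.sqrt S') := by
    simp only [hfun, ← hSdef, ← hS'def]
    ring
  rw [e]
  calc |(pre m L i y - pre m L i y') / Real.sqrt S + pre m L i y' * (1 / Real.sqrt S - 1 / Real.sqrt S')|
      ≤ |(pre m L i y - pre m L i y') / Real.sqrt S| + |pre m L i y' * (1 / Real.sqrt S - 1 / Real.sqrt S')| :=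
        abs_add_le _ _
    _ ≤ lam + 1 * (|S - S'| / 2) := by
        refine add_le_add ?_ ?_
        · rw [abs_div, abs_of_pos (show (0 : ℝ) < Real.sqrt S by linarith)]
          calc |pre m L i y - pre m L i y'| / Real.sqrt S ≤ |pre m L i y - pre m L i y'| / 1 :=
              div_le_div_of_nonneg_left (abs_nonneg _) one_pos hsqS
            _ ≤ lam := by rw [div_one]; exact abs_pre_sub_le_of_adj hm hL hn i h
        · rw [abs_mul, abs_of_nonneg ha']
          exact mul_le_mul ha'1 (abs_inv_sqrt_sub_le hS hS') (abs_nonneg _) zero_le_one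
    _ ≤ lam + 3 * 2 ^ (d + 1) * lam := by linarith
    _ = (1 + 3 * 2 ^ (d + 1)) * (3 * π / 2) * L / m := by rw [hlam]; ring

/-- **The Lipschitz bound (binder `hLip`) on the tower**: |h_□(y) − h_□(y″)| ≤ s∕M · d(y, y″) with
s = (1 + 3·2^{d+1})·(3π∕2)·L — all that the first-order expansion (2.83) uses of *"h ∈ C₀^∞"* (D-b06.42 (iv), (v)).
[cite: Balaban1984PropagatorsII, p.238 before (2.85) «gives a factor O(M⁻¹)»; (2.85)] -/
theorem abs_hfun_sub_le {m L : ℕ} (hm : 0 < m) (hL : 1 ≤ L) (hLn : L ≤ n) (i : Idx d k n) (y y'' : TW d k (n * m)) :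
    |hfun m L i y - hfun m L i y''| ≤ (1 + 3 * 2 ^ (d + 1)) * (3 * π / 2) * L / m * tdist L y y'' :=
  abs_sub_le_mul_tdist L (Φ := fun z => hfun m L i z) (fun _ _ h => abs_hfun_sub_le_of_adj hm hL hLn i h) y y''

/-- **THE TWO-SCALE STRUCTURE OF EVERY CUBE WITH ITS SCALE INDEX (binder `hcube`)**: under 1 ≤ L ≤ n every site of □
has level j_□ or j_□ + 1 — a cube of 𝒟_l meets only levels l − 1, l, l + 1 (`B6TowerSums.inReach_two_scale`); a cube
centred on the near face (c₀ = 0, frame window [−M, M] in x₀) misses level l + 1 (whose frames have x₀ ≥ nM + 1 > M),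
any other cube (c₀ ≥ 1, window ⊂ [0, ∞[) misses level l − 1 (x₀-frames ≤ −1∕L). [cite: Balaban1984PropagatorsII, p.230 + p.237 (2.81)] -/
theorem js_spec {m L : ℕ} (hL : 1 ≤ L) (hLn : L ≤ n) {i : Idx d k n} {y : TW d k (n * m)} (h : InCube m L i y) :
    js i ≤ lvl y ∧ lvl y ≤ js i + 1 := by
  obtain ⟨l, c⟩ := i
  have hn : 1 ≤ n := le_trans hL hLn
  have hLpos : (0 : ℝ) < L := by exact_mod_cast hL
  have hup : lvl y ≤ (l : ℕ) + 1 := lvl_le_of_inCube hL hn h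
  have hdown : (l : ℕ) ≤ lvl y + 1 := le_lvl_of_inCube hL hLn h
  have h0 : |frame L (l : ℕ) y 0 - ctr m c 0| ≤ m := h 0
  simp only [js]
  split_ifs with hc
  · -- centre on the near face: no site of level l + 1
    have hne : lvl y ≠ (l : ℕ) + 1 := by
      intro habove
      have hf := frame_zero_ge_of_above hL habove
      have hc0 : ctr m c 0 = 0 := by rw [ctr, hc, Nat.cast_zero, zero_mul]
      rw [hc0, sub_zero] at h0
      have h1 := (le_abs_self _).trans h0
      have h2 : (m : ℝ) ≤ ((n * m : ℕ) : ℝ) := by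
        push_cast
        exact le_mul_of_one_le_left (Nat.cast_nonneg m) (by exact_mod_cast hn)
      linarith
    constructor <;> omega
  · -- centre off the near face: no site of level l − 1
    have hne : lvl y + 1 ≠ (l : ℕ) := by
      intro hbelow
      have hf := frame_zero_le_of_below hL hbelow
      have hc1 : (m : ℝ) ≤ ctr m c 0 := by
        rw [ctr]
        exact le_mul_of_one_le_left (Nat.cast_nonneg m) (by exact_mod_cast Nat.one_le_iff_ne_zero.mpr hc)
      have h1 : ctr m c 0 - frame L (l : ℕ) y 0 ≤ m := by
        rw [abs_sub_comm] at h0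
        exact (le_abs_self _).trans h0
      have h3 : 0 < 1 / (L : ℝ) := by positivity
      linarith
    constructor <;> omega

/-- **The support gap (binder `hgap`) on the tower**: □ y = 0 and h_□(y″) ≠ 0 ⟹ d(y, y″) ≥ M∕(3L) — follow a shortest
contour from y″ (inside □) to y to its first exit x from □: the level-l frame differs by > M∕3 in one coordinate between x
and y″ and has moved by ≤ L per bond. [cite: Balaban1984PropagatorsII, p.229 (2.36); p.237 (2.83)] -/
theorem gap_of_cubeInd_eq_zero {m L : ℕ} (hm : 0 < m) (hL : 1 ≤ L) (hn : 1 ≤ n) {i : Idx d k n} {y y'' : TW d k (n * m)}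
    (hy : cubeInd m L i y = 0) (hy'' : hfun m L i y'' ≠ 0) : 1 / (3 * (L : ℝ)) * m ≤ tdist L y y'' := by
  have hL' : (0 : ℝ) < L := by exact_mod_cast hL
  have hnot : ¬ InCube m L i y := fun h => by rw [cubeInd_eq_one h] at hy; exact one_ne_zero hy
  have hpre := pre_ne_zero_of_hfun_ne_zero hy''
  obtain ⟨W, hW⟩ := ((graph_connected (d := d) (k := k) (a := n * m) L).preconnected y'' y).exists_walk_length_eq_dist
  obtain ⟨x, hx, hb⟩ := exists_exit hL (i.1 : ℕ) (P := InCube m L i) (fun z hz => lvl_le_of_inCube hL hn hz) W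
    (inCube_of_pre_ne_zero hm hpre) hnot
  obtain ⟨μ, hμ⟩ := exists_gt_of_not_inCubeR hm hx hpre
  have key : 1 / 3 * (m : ℝ) < L * tdist L y y'' := by
    calc 1 / 3 * (m : ℝ) < |frame L (i.1 : ℕ) x μ - frame L (i.1 : ℕ) y'' μ| := hμ
      _ = |frame L (i.1 : ℕ) y'' μ - frame L (i.1 : ℕ) x μ| := abs_sub_comm _ _
      _ ≤ ∑ ν, |frame L (i.1 : ℕ) y'' ν - frame L (i.1 : ℕ) x ν| :=
          Finset.single_le_sum (f := fun ν => |frame L (i.1 : ℕ) y'' ν - frame L (i.1 : ℕ) x ν|)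
            (fun ν _ => abs_nonneg _) (Finset.mem_univ μ)
      _ ≤ L * (W.length : ℝ) := hb
      _ = L * tdist L y y'' := by rw [hW, tdist_comm]; rfl
  rw [show 1 / (3 * (L : ℝ)) * m = (1 / 3 * (m : ℝ)) / L by field_simp, div_le_iff₀ hL']
  linarith

/-- **The collar (binder `hcollar`) on the tower**: y ∈ □, z ∉ □̃ ⟹ d(y, z) ≥ M∕L — follow a shortest contour from y to
z to its first exit x from □̃ (upward blind, n ≥ 2): the level-l frames of y and x differ by > M in one coordinate and the
frame has moved by ≤ L per bond. [cite: Balaban1984PropagatorsII, p.235 before (2.70)] -/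
theorem collar {m L : ℕ} (hL : 1 ≤ L) (hn : 2 ≤ n) {i : Idx d k n} {y z : TW d k (n * m)} (hy : InCube m L i y)
    (hz : ¬ InBig m L i z) : (m : ℝ) / L ≤ tdist L y z := by
  have hL' : (0 : ℝ) < L := by exact_mod_cast hL
  obtain ⟨W, hW⟩ := ((graph_connected (d := d) (k := k) (a := n * m) L).preconnected y z).exists_walk_length_eq_dist
  obtain ⟨x, hx, hb⟩ := exists_exit hL (i.1 : ℕ) (P := InBig m L i) (fun u hu => lvl_le_of_inBig hL hn hu) W
    (inBig_of_inCube hy) hz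
  obtain ⟨μ, hμ⟩ := exists_gt_of_not_inBigR hy hx
  have key : (m : ℝ) < L * tdist L y z := by
    calc (m : ℝ) < |frame L (i.1 : ℕ) y μ - frame L (i.1 : ℕ) x μ| := hμ
      _ ≤ ∑ ν, |frame L (i.1 : ℕ) y ν - frame L (i.1 : ℕ) x ν| :=
          Finset.single_le_sum (f := fun ν => |frame L (i.1 : ℕ) y ν - frame L (i.1 : ℕ) x ν|)
            (fun ν _ => abs_nonneg _) (Finset.mem_univ μ)
      _ ≤ L * (W.length : ℝ) := hb
      _ = L * tdist L y z := by rw [hW]; rfl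
  rw [div_le_iff₀ hL']
  linarith

/-- Membership in the zone N_□ (the binder `hzone` holds by construction). [folklore] -/
theorem mem_zone {m L : ℕ} {w : ℝ} {i : Idx d k n} {y : TW d k a} :
    y ∈ zone m L w i ↔ ∃ z, ¬ InBig m L i z ∧ tdist L y z ≤ w := by
  unfold zone
  simp only [Finset.mem_filter, Finset.mem_univ, true_and]

/-- **The zones are non-empty (binder `hN`)**: every □̃ misses a site of its own level (n ≥ 5: the own-level box is
wider than □̃). [cite: Balaban1984PropagatorsII, p.235 before (2.70)] -/
theorem zone_nonempty {m L : ℕ} (hm : 0 < m) (hL : 1 ≤ L) (hn : 5 ≤ n) {w : ℝ} (hw : 0 ≤ w) (i : Idx d k n) :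
    (zone m L w i : Finset (TW d k (n * m))).Nonempty := by
  have hp : frame L (i.1 : ℕ) ((i.1, fun _ => Fin.last (n * m)) : TW d k (n * m)) 0 = n * m := by
    have e := frame_self hL ((i.1, fun _ => Fin.last (n * m)) : TW d k (n * m)) 0
    simp only [Fin.val_last, Nat.cast_mul] at e
    exact e
  have hq : frame L (i.1 : ℕ) ((i.1, fun _ => (0 : Fin (n * m + 1))) : TW d k (n * m)) 0 = 0 := by
    have e := frame_self hL ((i.1, fun _ => (0 : Fin (n * m + 1))) : TW d k (n * m)) 0
    simp only [Fin.val_zero, Nat.cast_zero] at e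
    exact e
  obtain ⟨z, hz⟩ : ∃ z : TW d k (n * m), ¬ InBig m L i z := by
    rcases not_inBigR_of_far hm hn i.2 hp hq with h | h
    · exact ⟨_, h⟩
    · exact ⟨_, h⟩
  exact ⟨z, mem_zone.mpr ⟨z, hz, by rw [tdist_self]; exact hw⟩⟩

/-- **THE COVER STRADDLES EVERY INTERFACE, upwards**: the far-face cube of 𝒟_l (centre index (n, 0, …, 0)) contains the
near corner of level l + 1 (its level-l frame is (nM + 1, 0, …, 0); M ≥ 1) — the printed *"cube connected with a
L^jη-scale … intersecting … B^{j+1}(Λ_{j+1})"*. [cite: Balaban1984PropagatorsII, p.230] -/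
theorem inCube_above {m L : ℕ} (hm : 1 ≤ m) (hL : 1 ≤ L) (z z' : Fin (k + 1)) (h : (z' : ℕ) = z + 1) :
    InCube m L ((z, cornerA d n) : Idx d k n) ((z', 0) : TW d k (n * m)) := by
  intro μ
  show |frame L (z : ℕ) ((z', 0) : TW d k (n * m)) μ - ctr m (cornerA d n) μ| ≤ m
  have hm' : (1 : ℝ) ≤ m := by exact_mod_cast hm
  rw [frame_of_above hL (show lvl ((z', 0) : TW d k (n * m)) = (z : ℕ) + 1 from h), ctr, cornerA]
  by_cases hμ : μ = 0
  · simp only [hμ, if_true, Pi.zero_apply, Fin.val_zero, Nat.cast_zero, mul_zero, add_zero, Fin.val_last]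
    push_cast
    rw [show (n : ℝ) * m + 1 - n * m = 1 by ring, abs_one]
    exact hm'
  · simp only [hμ, if_false, Pi.zero_apply, Fin.val_zero, Nat.cast_zero, mul_zero, add_zero, zero_mul, sub_zero,
      abs_zero]
    positivity

/-- **… and downwards**: the near-face cube of 𝒟_{l+1} (centre index 0) contains the far corner of level l (its
level-(l+1) frame is (−1∕L, 0, …, 0); M, L ≥ 1) — a cube of 𝒟_{l+1} reaching one big block into B^l(Λ_l) (D-b06.42 (ii)).
[cite: Balaban1984PropagatorsII, (2.2) p.224 + p.229] -/
theorem inCube_below {m L : ℕ} (hm : 1 ≤ m) (hL : 1 ≤ L) (z z' : Fin (k + 1)) (h : (z' : ℕ) = z + 1) :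
    InCube m L ((z', 0) : Idx d k n) ((z, cornerA d (n * m)) : TW d k (n * m)) := by
  intro μ
  show |frame L (z' : ℕ) ((z, cornerA d (n * m)) : TW d k (n * m)) μ - ctr m (0 : Fin d → Fin (n + 1)) μ| ≤ m
  have hm' : (1 : ℝ) ≤ m := by exact_mod_cast hm
  have hL' : (1 : ℝ) ≤ L := by exact_mod_cast hL
  have hLpos : (0 : ℝ) < L := by positivity
  rw [frame_of_below hL (show lvl ((z, cornerA d (n * m)) : TW d k (n * m)) + 1 = (z' : ℕ) from h.symm)]
  by_cases hμ : μ = 0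
  · simp only [hμ, if_true, ctr, cornerA, Fin.val_last, Nat.cast_mul, Pi.zero_apply, Fin.val_zero, Nat.cast_zero,
      zero_mul, sub_zero]
    rw [show ((n : ℝ) * m - ((n : ℝ) * m + 1)) / L = -(1 / L) by ring, abs_neg, abs_of_pos (by positivity)]
    calc 1 / (L : ℝ) ≤ 1 := by rw [div_le_one hLpos]; exact hL'
      _ ≤ m := hm'
  · simp only [hμ, if_false, ctr, cornerA, Pi.zero_apply, Fin.val_zero, Nat.cast_zero, zero_div, zero_mul, sub_zero,
      abs_zero]
    positivity

end Cover

/-! ## §3  Proposition 2.3 on the (k+1)-level tower with its cube cover -/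

section Edge

variable (d : ℕ) [NeZero d] (k n m L : ℕ) (η R : ℝ)

/-- **PROPOSITION 2.3 ON THE (k+1)-LEVEL TOWER WITH ITS CUBE COVER, every k** —
`B6Prop23CubeDepth.prop23_assembled_fine_twoLevel_cubes` (p. 238 before (2.85) ⟹ (2.85) ⟹ Lemma 2.1 ⟹ (2.86)–(2.87),
change-of-domain input and depth binders discharged upstream) ON the tower `twGeo d k (nM) M L η R` of `B6LevelTower`
(k + 1 levels of boxes of (nM + 1)^d sites, big blocks of M sites, scale ratio L) with the cover 𝒟 = ⋃_{l=0}^{k} 𝒟_l of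
§2: □_i := `cubeInd m L i` (i = (l, c), c ∈ {0, …, n}^d), h_i := `hfun m L i` = h̃_i·S^{−1∕2}, j_□ := `js` (the finest
level □ meets), □̃_i := `InBig m L i`, N_i := `zone m L w i`.  DISCHARGED: the geometry side hρ, hsep ((2.2) with
content: RM ≤ nM + 1), h260, hK, hPr, h261σ, h261, h263, hc by `B6TowerSums.twGeo_prop23_geometry` (constants K_TW of
`B6TowerSums`), hM, and the cover side hover (n₀ = 3·2^d), hpf01, hph, h236, hLip (s = (1 + 3·2^{d+1})·(3π∕2)·L), hcube,
hgap (m_g = 1∕(3L)), hN, hκ (κ = 1∕(2L)), hpfsq, hhsq, hcollar (M_c = M∕L), hzone, hdepth by §2; the model needs d ≥ 1,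
M ≥ 1, n ≥ 5, L ∈ ℕ with 1 ≤ L ≤ n (D-b06.42 (iii)), 0 ≤ RM ≤ nM + 1, a zone width 0 ≤ w with 2wL ≤ M.  Kept VERBATIM
(with these substitutions): hη, the located size condition hsize and the threshold hthr, the rates (hα′, hκδ, hB₁, hθ,
hδ₁ > 0, hsplit, σ > 0), the kernels X, X̃_i, C_i with hX ∕ hXw, (2.81) h281 (at the scale L^{j_□}η of each cube), hCk0,
(2.70) h270, the fine-lattice data blk, χ_i, D_i, G′, G′(□̃_i) with hχ1, hpfχ, hhχ, hχN, hGD, hDG, hχGw, hGwχ and the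
majorants hG, hGw, hKGw, hKG, the Q′-data, the dictionary hXdef ∕ hXwdef, and «M large» hKM with the model's constants;
conclusion verbatim: the two-sided inverse of Q′G′²Q′* in the pairing (2.69), its glued form (2.86), uniqueness, (2.87).
[cite: Balaban1984PropagatorsII, Proposition 2.3 (2.85)–(2.87) p.238; (2.36) p.229; p.230; p.235 before (2.70)] -/
theorem prop23_assembled_towerBox (hm : 0 < m) (hn : 5 ≤ n) (hL : 1 ≤ L) (hLn : L ≤ n) (hη : 0 < η)
    (hR0 : 0 ≤ R * m) (hRa : R * m ≤ (n : ℝ) * m + 1)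
    {X : Type}
    -- the fine-lattice side: blocks, the located size condition
    (blk : X → (twGeo d k (n * m) m L η R).Site) {δ₀ α' : ℝ} (hα' : 0 ≤ α' * δ₀)
    (hsize : (L : ℝ) ^ 2 * Real.exp (-(α' * δ₀ * (R * m))) ≤ 1)
    {δ B₁ θ : ℝ} (hκδ : α' * δ₀ < δ) (hB₁ : 0 ≤ B₁) (hθ : 0 ≤ θ)
    -- the rates of the assembled Prop. 2.3 (its δ₀ is (δ − α′δ₀)/3)
    {δ₁ σ BX BC : ℝ} (hδ₁ : 0 < δ₁) (hsplit : δ₁ + σ * ((δ - α' * δ₀) / 3) ≤ (δ - α' * δ₀) / 3 / 4) (hσ : 0 < σ)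
    (hthr : (L : ℝ) ^ 4 ≤ Real.exp (1 / 8 * ((δ - α' * δ₀) / 3) * R * m))
    (hBX : 0 ≤ BX) (hBC : 0 ≤ BC)
    -- the kernels X, X̃_i, C_i in the pairing (2.69)
    {Xk : (twGeo d k (n * m) m L η R).Site → (twGeo d k (n * m) m L η R).Site → ℝ}
    {Xwk Ck : Idx d k n → (twGeo d k (n * m) m L η R).Site → (twGeo d k (n * m) m L η R).Site → ℝ}
    (hX : ∀ y y'', |(twGeo d k (n * m) m L η R).len y'' ^ d * Xk y y''| ≤
      BX * (twGeo d k (n * m) m L η R).len y ^ 4 *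
        Real.exp (-(1 / 2 * ((δ - α' * δ₀) / 3) * (twGeo d k (n * m) m L η R).dist y y'')))
    (hXw : ∀ i y y'', |(twGeo d k (n * m) m L η R).len y'' ^ d * Xwk i y y''| ≤
      BX * (twGeo d k (n * m) m L η R).len y ^ 4 *
        Real.exp (-(1 / 2 * ((δ - α' * δ₀) / 3) * (twGeo d k (n * m) m L η R).dist y y'')))
    (h281 : ∀ i y y', cubeInd m L i y ≠ 0 → cubeInd m L i y' ≠ 0 →
      |Ck i y y'| ≤
        BC / ((twGeo d k (n * m) m L η R).L ^ js i * (twGeo d k (n * m) m L η R).eta) ^ (d + 4) *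
          Real.exp (-(δ₁ * (twGeo d k (n * m) m L η R).dist y y')))
    (hCk0 : ∀ i y'' y', cubeInd m L i y'' = 0 → Ck i y'' y' = 0)
    (h270 : ∀ i, locOp (fun i => B6Expansion282.mulOp (cubeInd m L i))
        (fun i => kerOp (fun z => (twGeo d k (n * m) m L η R).len z ^ d) (Xwk i)) i *
      kerOp (fun z => (twGeo d k (n * m) m L η R).len z ^ d) (Ck i) * B6Expansion282.mulOp (hfun m L i) =
        B6Expansion282.mulOp (hfun m L i))
    -- the fine-lattice data of each cube: cut-off χ_i, D_i, G′(□̃_i) = Gw i; G′ = G, Q′ = Qp, Q′* = Qs; zone width w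
    {w : ℝ} (hw0 : 0 ≤ w) (hw : 2 * w * L ≤ m)
    {G : Module.End ℝ (X → ℝ)} {Dop Gw : Idx d k n → Module.End ℝ (X → ℝ)}
    {χ : Idx d k n → X → ℝ}
    (hχ1 : ∀ i x, |χ i x| ≤ 1)
    (hpfχ : ∀ i x, cubeInd m L i (blk x) * χ i x = cubeInd m L i (blk x))
    (hhχ : ∀ i x, χ i x * hfun m L i (blk x) = hfun m L i (blk x))
    (hχN : ∀ i x, blk x ∉ zone m L w i → χ i x = 1)
    (hGD : ∀ i, G * Dop i = 1) (hDG : ∀ i, Dop i * G = 1)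
    (hχGw : ∀ i, B9Thm37Sum.mulOp (χ i) * Dop i * Gw i = B9Thm37Sum.mulOp (χ i))
    (hGwχ : ∀ i, Gw i * Dop i * B9Thm37Sum.mulOp (χ i) = B9Thm37Sum.mulOp (χ i))
    (hG : HasMajorant blk G (fun a b => B₁ * (twGeo d k (n * m) m L η R).len a ^ 2 *
      Real.exp (-(δ * (twGeo d k (n * m) m L η R).dist a b))))
    (hGw : ∀ i, HasMajorant blk (Gw i) (fun a b => B₁ * (twGeo d k (n * m) m L η R).len a ^ 2 *
      Real.exp (-(δ * (twGeo d k (n * m) m L η R).dist a b))))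
    (hKGw : ∀ i, HasMajorant blk ((B9Thm37Sum.mulOp (χ i) * Dop i - Dop i * B9Thm37Sum.mulOp (χ i)) * Gw i)
      (fun a b => (if a ∈ zone m L w i then θ else 0) * Real.exp (-(δ * (twGeo d k (n * m) m L η R).dist a b))))
    (hKG : ∀ i, HasMajorant blk ((B9Thm37Sum.mulOp (χ i) * Dop i - Dop i * B9Thm37Sum.mulOp (χ i)) * G)
      (fun a b => (if a ∈ zone m L w i then θ else 0) * Real.exp (-(δ * (twGeo d k (n * m) m L η R).dist a b))))
    -- the Q′-data
    {Qp : (X → ℝ) →ₗ[ℝ] ((twGeo d k (n * m) m L η R).Site → ℝ)}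
    {Qs : ((twGeo d k (n * m) m L η R).Site → ℝ) →ₗ[ℝ] (X → ℝ)}
    {cQ cQs : ℝ} (hcQ : 0 ≤ cQ) (hcQs : 0 ≤ cQs)
    (hQ : HasMajorantHom blk (fun y : (twGeo d k (n * m) m L η R).Site => y) Qp
      (fun (a b : (twGeo d k (n * m) m L η R).Site) => cQ * (if a = b then (1 : ℝ) else 0)))
    (hQs : HasMajorantHom (fun y : (twGeo d k (n * m) m L η R).Site => y) blk Qs
      (fun (a b : (twGeo d k (n * m) m L η R).Site) => cQs * (if a = b then (1 : ℝ) else 0)))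
    (hQχ : ∀ i : Idx d k n,
      (B9Thm37Sum.mulOp (cubeInd m L i) : Module.End ℝ ((twGeo d k (n * m) m L η R).Site → ℝ)) ∘ₗ Qp =
      Qp ∘ₗ (B9Thm37Sum.mulOp (cubeInd m L i ∘ blk) : Module.End ℝ (X → ℝ)))
    (hQsh : ∀ i : Idx d k n,
      Qs ∘ₗ (B9Thm37Sum.mulOp (hfun m L i) : Module.End ℝ ((twGeo d k (n * m) m L η R).Site → ℝ)) =
      (B9Thm37Sum.mulOp (hfun m L i ∘ blk) : Module.End ℝ (X → ℝ)) ∘ₗ Qs)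
    -- the dictionary (definitions of X, X̃_i as the (2.69)-kernels of Q′G′²Q′*, Q′G′(□̃_i)²Q′*)
    (hXdef : kerOp (fun z => (twGeo d k (n * m) m L η R).len z ^ d) Xk = Qp ∘ₗ (G * G) ∘ₗ Qs)
    (hXwdef : ∀ i, kerOp (fun z => (twGeo d k (n * m) m L η R).len z ^ d) (Xwk i) = Qp ∘ₗ (Gw i * Gw i) ∘ₗ Qs)
    -- «M large enough», with the model's constants
    (hKM : 2 * K285TL (twGeo d k (n * m) m L η R) d (3 * 2 ^ d) ((1 + 3 * 2 ^ (d + 1)) * (3 * π / 2) * L)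
      ((δ - α' * δ₀) / 3) (Ktw d L (σ * ((δ - α' * δ₀) / 3))) ((δ - α' * δ₀) / 3 * (1 / (2 * (L : ℝ))))
      (1 / (3 * (L : ℝ))) BX (cQ * cQs * ((twGeo d k (n * m) m L η R).L ^ 2 * Ctot (Ktw d L) B₁ θ (δ - α' * δ₀))) BC *
      Ktw d L (1 / 2 * δ₁) ≤ (twGeo d k (n * m) m L η R).M) :
    ∃ Ginv : Module.End ℝ ((twGeo d k (n * m) m L η R).Site → ℝ),
      Ginv * kerOp (fun z => (twGeo d k (n * m) m L η R).len z ^ d) Xk = 1 ∧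
      kerOp (fun z => (twGeo d k (n * m) m L η R).len z ^ d) Xk * Ginv = 1 ∧
      Ginv = Cglued (fun i => B6Expansion282.mulOp (hfun m L i))
          (fun i => kerOp (fun z => (twGeo d k (n * m) m L η R).len z ^ d) (Ck i)) +
        Ginv * R282 (kerOp (fun z => (twGeo d k (n * m) m L η R).len z ^ d) Xk)
          (fun i => B6Expansion282.mulOp (cubeInd m L i))
          (fun i => kerOp (fun z => (twGeo d k (n * m) m L η R).len z ^ d) (Xwk i))
          (fun i => B6Expansion282.mulOp (hfun m L i))
          (fun i => kerOp (fun z => (twGeo d k (n * m) m L η R).len z ^ d) (Ck i)) ∧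
      (∀ G' : Module.End ℝ ((twGeo d k (n * m) m L η R).Site → ℝ),
        G' * kerOp (fun z => (twGeo d k (n * m) m L η R).len z ^ d) Xk = 1 → G' = Ginv) ∧
      ∀ y y', |mat Ginv y y' / (twGeo d k (n * m) m L η R).len y' ^ d| ≤
        2 * ((3 * 2 ^ d : ℕ) * (BC * (twGeo d k (n * m) m L η R).L ^ (d + 4))) * Ktw d L (1 / 2 * δ₁) *
          (twGeo d k (n * m) m L η R).len y ^ (-(4 : ℝ)) *
          (twGeo d k (n * m) m L η R).len y' ^ (-(d : ℝ)) *
          Real.exp (-(δ₁ / 2 * (twGeo d k (n * m) m L η R).dist y y')) := by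
  have hn1 : 1 ≤ n := le_trans (by norm_num) hn
  have hn2 : 2 ≤ n := le_trans (by norm_num) hn
  have hLr : (1 : ℝ) ≤ (L : ℝ) := by exact_mod_cast hL
  have hLr0 : (0 : ℝ) < (L : ℝ) := by positivity
  have hM : 0 < (twGeo d k (n * m) m L η R).M := by
    show (0 : ℝ) < m
    exact_mod_cast hm
  have hRa' : R * m ≤ ((n * m : ℕ) : ℝ) + 1 := by
    push_cast
    exact hRa
  have hdepth : 1 / (2 * (L : ℝ)) * (m : ℝ) ≤ (m : ℝ) / L - w := depth_interface hLr0 hw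
  obtain ⟨hρ, hsep, h260, hK, hPr, h261σ, h261, h263, hc⟩ :=
    twGeo_prop23_geometry d k (n * m) m L η R hL hRa' hα' hκδ hσ hδ₁
  exact prop23_assembled_fine_twoLevel_cubes (g := twGeo d k (n * m) m L η R) (ι := Idx d k n) (pf := cubeInd m L)
    (hf := hfun m L) (js := js) (n₀ := 3 * 2 ^ d) (sq := InCube m L) (bsq := InBig m L)
    (Mc := (m : ℝ) / L) (κ := 1 / (2 * (L : ℝ)))
    d hρ hsep hLr hη hM hR0 blk h260 hK hPr hα' hsize hκδ hB₁ hθ hδ₁.le hsplit h261σ hthr h261 h263 hc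
    (by positivity) (by positivity) hBX hBC
    (fun y => card_filter_hfun_ne_zero_le hm hL hLn y) (cubeInd_zero_or_one m L) (cubeInd_mul_hfun hm L)
    (sum_hfun_sq hm hL) (abs_hfun_sub_le hm hL hLn)
    (fun _ _ h => js_spec hL hLn (inCube_of_cubeInd_ne_zero h))
    (fun _ _ _ hy hy'' => gap_of_cubeInd_eq_zero hm hL hn1 hy hy'') hX hXw h281 hCk0 h270 (zone m L w)
    (zone_nonempty hm hL hn hw0) hχ1 hpfχ hhχ hχN hGD hDG hχGw hGwχ hG hGw hKGw hKG (by positivity)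
    (fun _ _ h => inCube_of_cubeInd_ne_zero h) (fun _ _ h => inCube_of_pre_ne_zero hm (pre_ne_zero_of_hfun_ne_zero h))
    (fun _ _ _ hy hz => collar hL hn2 hy hz) (fun _ _ hx => mem_zone.mp hx) hdepth hcQ hcQs hQ hQs hQχ hQsh
    hXdef hXwdef hKM

end Edge

/-! ## §4  The model hypotheses hold together on a tower with two interfaces -/

/-- **Non-vacuity on three levels.**  The side conditions of the edge theorem (M ≥ 1, n ≥ 5, 1 ≤ L ≤ n, 0 ≤ w, 2wL ≤ M,
0 ≤ RM ≤ nM + 1) hold together — d = 1, k = 2 (levels 0, 1, 2: two interfaces), n = 5, M = 4, L = 2, w = 1, R = 5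
(RM = 20 ≤ 21) — and on that tower: every zone N_□ is non-empty, (2.36) holds at every site for the normalised family,
at most 3·2^d = 6 cubes meet any site, every cube is two-scale with its scale index, and the cover straddles BOTH
interfaces in both directions (far-face cubes of 𝒟_0, 𝒟_1 contain the near corners of levels 1, 2; near-face cubes of
𝒟_1, 𝒟_2 contain the far corners of levels 0, 1) — the (k+1)-level content that no two-level carrier has. [folklore] -/
theorem towerCover_nonvacuous :
    ∃ d k n m L : ℕ, ∃ _ : NeZero d, ∃ w R : ℝ, 0 < m ∧ 5 ≤ n ∧ 1 ≤ L ∧ L ≤ n ∧ 0 ≤ w ∧ 2 * w * L ≤ m ∧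
      0 ≤ R * m ∧ R * m ≤ (n : ℝ) * m + 1 ∧ 2 ≤ k ∧
      (∀ i : Idx d k n, (zone m L w i : Finset (TW d k (n * m))).Nonempty) ∧
      (∀ y : TW d k (n * m), ∑ i : Idx d k n, hfun m L i y ^ 2 = 1) ∧
      (∀ y : TW d k (n * m), (Finset.univ.filter fun i : Idx d k n => hfun m L i y ≠ 0).card ≤ 3 * 2 ^ d) ∧
      (∀ (i : Idx d k n) (y : TW d k (n * m)), cubeInd m L i y ≠ 0 → js i ≤ lvl y ∧ lvl y ≤ js i + 1) ∧
      (∀ z z' : Fin (k + 1), (z' : ℕ) = z + 1 →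
        InCube m L ((z, cornerA d n) : Idx d k n) ((z', 0) : TW d k (n * m)) ∧
        InCube m L ((z', 0) : Idx d k n) ((z, cornerA d (n * m)) : TW d k (n * m))) := by
  refine ⟨1, 2, 5, 4, 2, inferInstance, 1, 5, by norm_num, le_rfl, by norm_num, by norm_num, zero_le_one, by norm_num,
    by norm_num, by norm_num, le_rfl, ?_, ?_, ?_, ?_, ?_⟩
  · exact fun i => zone_nonempty (by norm_num) (by norm_num) le_rfl zero_le_one i
  · exact fun y => sum_hfun_sq (by norm_num) (by norm_num) y
  · exact fun y => card_filter_hfun_ne_zero_le (by norm_num) (by norm_num) (by norm_num) y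
  · exact fun i y h => js_spec (by norm_num) (by norm_num) (inCube_of_cubeInd_ne_zero h)
  · exact fun z z' h => ⟨inCube_above (by norm_num) (by norm_num) z z' h, inCube_below (by norm_num) (by norm_num) z z' h⟩

end Literature.MathematicalPhysics.QuantumFieldTheory.Balaban1983to89.B6TowerCover
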